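import Mathlib
import Summits.Ventures.DiscreteObjects.Mahler.SalemStructure
import Summits.Ventures.DiscreteObjects.Mahler.PisotLowerBound

/-!
# An explicit lower bound for Salem-type measures by degree (venture `DiscreteObjects`, target L)

Cell `pub-namedobj`, seat `pub-namedobj-mahler` (gen 10). Framing: lottery ticket; floor = certified
bounds/negative ranges.

For an irreducible `P ∈ ℤ[X]` of Salem type (one complex root `τ` outside the closed unit disc, the other
roots in the disc, at least one on the circle; cf. `salem_structure_of_irreducible`) of degree `n`:
`P(1) = lc · (1 - τ)(1 - τ⁻¹) ∏_{|ζ|=1} (1 - ζ)` is a nonzero integer and `|1 - ζ| ≤ 2`, whence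
(using `P(-1)` instead when `τ < 0`)

  `|τ| ≤ (|τ| - 1)² · 2^{n-2}`,  in particular  `|τ| > 1 + 2^{1 - n/2}`.

So Salem numbers of degree `n` are `> 1 + 2^{1-n/2}` — a crude but explicit, degree-uniform kernel bound
(folklore); e.g. a Salem-type measure below Lehmer's `1.17628…` needs degree `≥ 8`.

* `salem_measure_lower_bound` — `‖τ‖ ≤ (‖τ‖ - 1)² · 2^{n-2}` (for `|lc| = 1`: `M(P) = ‖τ‖`);
* `eight_le_natDegree_of_salem_lt` — Salem type with `M(P) < 1.17629` and `|lc| = 1` ⇒ `deg P ≥ 8`.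
-/

namespace Summit.Ventures.DiscreteObjects.Mahler

open Polynomial
open scoped ComplexConjugate

/-- **Explicit Salem bound.**  Irreducible `P ∈ ℤ[X]` with `|lc(P)| = 1`, a root `α` with `‖α‖ > 1`, all
other roots in the closed unit disc and some root on the unit circle: `‖α‖ ≤ (‖α‖ - 1)² · 2^{deg P - 2}`. -/
theorem salem_measure_lower_bound {P : ℤ[X]} (hirr : Irreducible P)
    (hlc : P.leadingCoeff = 1 ∨ P.leadingCoeff = -1) {α ζ : ℂ}
    (hα : α ∈ (P.map (Int.castRingHom ℂ)).roots) (hα1 : 1 < ‖α‖)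
    (hothers : ∀ β ∈ ((P.map (Int.castRingHom ℂ)).roots).erase α, ‖β‖ ≤ 1)
    (hζ : ζ ∈ (P.map (Int.castRingHom ℂ)).roots) (hζ1 : ‖ζ‖ = 1) :
    ‖α‖ ≤ (‖α‖ - 1) ^ 2 * 2 ^ (P.natDegree - 2) := by
  classical
  have hP : P ≠ 0 := hirr.ne_zero
  have hinj := (Int.castRingHom ℂ).injective_int
  set Pc := P.map (Int.castRingHom ℂ) with hPc
  have hPc0 : Pc ≠ 0 := (Polynomial.map_ne_zero_iff hinj).mpr hP
  set R := Pc.roots with hR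
  obtain ⟨hrev, heven, hconj, hinvR, hunit, hM⟩ := salem_structure_of_irreducible hirr hα hα1 hothers hζ hζ1
  -- degree and root count
  have hαζ : α ≠ ζ := by intro h; rw [h, hζ1] at hα1; exact lt_irrefl _ hα1
  have hcard : Multiset.card R = P.natDegree := by
    have hsp := (IsAlgClosed.splits Pc).natDegree_eq_card_roots
    rw [hPc, natDegree_map_eq_of_injective hinj] at hsp
    rw [hR, hPc]; exact hsp.symm
  have hnodup : R.Nodup := by
    have hdeg : 0 < P.natDegree := by
      have h2 : 2 ≤ Multiset.card R := by
        have h1 : ({α, ζ} : Multiset ℂ) ≤ R := by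
          rw [Multiset.le_iff_subset (by simp [hαζ])]
          intro x hx; simp at hx; rcases hx with rfl | rfl <;> assumption
        simpa using Multiset.card_le_card h1
      omega
    exact nodup_roots_of_irreducible hirr hdeg
  have hα0 : α ≠ 0 := by intro h; rw [h, norm_zero] at hα1; linarith
  have hαinv_ne : α⁻¹ ≠ α := by
    intro h
    have : ‖α⁻¹‖ = ‖α‖ := by rw [h]
    rw [norm_inv] at this
    have h1 : ‖α‖⁻¹ < 1 := inv_lt_one_of_one_lt₀ hα1
    linarith
  -- `R = α :: α⁻¹ :: T` with `T` in the closed disc, `|T| = n - 2`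
  set T := (R.erase α).erase α⁻¹ with hT
  have hαinvRe : α⁻¹ ∈ R.erase α := (Multiset.mem_erase_of_ne hαinv_ne).mpr hinvR
  have hRT : R = α ::ₘ α⁻¹ ::ₘ T := by rw [hT, Multiset.cons_erase hαinvRe, Multiset.cons_erase hα]
  have hTcard : Multiset.card T = P.natDegree - 2 := by
    have := congrArg Multiset.card hRT
    rw [hcard, Multiset.card_cons, Multiset.card_cons] at this; omega
  have hTle : ∀ β ∈ T, ‖β‖ ≤ 1 := fun β hβ => hothers β (Multiset.mem_of_mem_erase hβ)
  -- `P(ε) = lc · ∏ (ε - β)`, `|P(ε)| ≥ 1`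
  have hnoroot : ∀ t : ℤ, P.eval t ≠ 0 := by
    intro t ht
    have hdvd : X - C t ∣ P := dvd_iff_isRoot.mpr ht
    have hass : Associated (X - C t) P := (irreducible_X_sub_C t).associated_of_dvd hirr hdvd
    have h1 := natDegree_eq_of_degree_eq (degree_eq_degree_of_associated hass)
    rw [natDegree_X_sub_C] at h1
    have : 2 ≤ P.natDegree := by
      rw [← hcard, hRT]; simp
    omega
  have hsplit : Pc = C Pc.leadingCoeff * (R.map fun β => X - C β).prod := (IsAlgClosed.splits Pc).eq_prod_roots
  have hlcC : ‖Pc.leadingCoeff‖ = 1 := by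
    rw [hPc, leadingCoeff_map_of_injective hinj, eq_intCast, Complex.norm_intCast]
    rcases hlc with h | h <;> simp [h]
  have heval1 : ∀ ε : ℤ, (1 : ℝ) ≤ ‖(R.map fun β => (ε : ℂ) - β).prod‖ := by
    intro ε
    have h1 : ((P.eval ε : ℤ) : ℂ) = Pc.leadingCoeff * (R.map fun β => (ε : ℂ) - β).prod := by
      have : ((P.eval ε : ℤ) : ℂ) = Pc.eval (ε : ℂ) := by
        rw [hPc, eval_intCast_map, eq_intCast, Int.cast_id]
      rw [this]
      conv_lhs => rw [hsplit]
      rw [eval_mul, eval_C, eval_multiset_prod, Multiset.map_map]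
      congr 1
      exact congrArg _ (Multiset.map_congr rfl fun β _ => by simp)
    have h2 : (1 : ℝ) ≤ ‖((P.eval ε : ℤ) : ℂ)‖ := by
      rw [Complex.norm_intCast]; exact_mod_cast Int.one_le_abs (hnoroot ε)
    rwa [h1, norm_mul, hlcC, one_mul] at h2
  -- `∏_T |ε - β| ≤ 2^{n-2}`
  have hT2 : ∀ ε : ℂ, ‖ε‖ = 1 → ‖(T.map fun β => ε - β).prod‖ ≤ 2 ^ (P.natDegree - 2) := by
    intro ε hε
    rw [← normHom_apply, map_multiset_prod, Multiset.map_map]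
    have h : (T.map (⇑normHom ∘ fun β => ε - β)).prod ≤ (T.map fun _ => (2 : ℝ)).prod := by
      refine Multiset.prod_map_le_prod_map₀ _ _ (fun β _ => by simp) (fun β hβ => ?_)
      simp only [Function.comp_apply, normHom_apply]
      calc ‖ε - β‖ ≤ ‖ε‖ + ‖β‖ := norm_sub_le _ _
        _ ≤ 1 + 1 := add_le_add hε.le (hTle β hβ)
        _ = 2 := by norm_num
    rwa [Multiset.map_const', Multiset.prod_replicate, hTcard] at h
  -- the bound at `ε` with `|ε - α| = ‖α‖ - 1`
  have key : ∀ ε : ℤ, (ε = 1 ∨ ε = -1) → ‖(ε : ℂ) - α‖ = ‖α‖ - 1 →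
      ‖α‖ ≤ (‖α‖ - 1) ^ 2 * 2 ^ (P.natDegree - 2) := by
    intro ε hε hn
    have hε1 : ‖(ε : ℂ)‖ = 1 := by rcases hε with h | h <;> simp [h]
    have h := heval1 ε
    rw [hRT, Multiset.map_cons, Multiset.map_cons, Multiset.prod_cons, Multiset.prod_cons, norm_mul,
      norm_mul] at h
    have hinv : ‖(ε : ℂ) - α⁻¹‖ = ‖(ε : ℂ) - α‖ / ‖α‖ := by
      have : (ε : ℂ) - α⁻¹ = ((ε : ℂ) * α - 1) / α := by field_simp
      rw [this, norm_div]
      congr 1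
      have hεα : (ε : ℂ) * α - 1 = (ε : ℂ) * (α - (ε : ℂ)) := by
        rcases hε with h | h
        · simp [h]
        · simp [h]; ring
      rw [hεα, norm_mul, hε1, one_mul, norm_sub_rev]
    rw [hinv, hn] at h
    have hpos : 0 < ‖α‖ := by linarith
    have h3 := hT2 (ε : ℂ) hε1
    have h4 : (1 : ℝ) ≤ (‖α‖ - 1) * ((‖α‖ - 1) / ‖α‖) * 2 ^ (P.natDegree - 2) := by
      calc (1 : ℝ) ≤ (‖α‖ - 1) * ((‖α‖ - 1) / ‖α‖) * ‖(T.map fun β => (ε : ℂ) - β).prod‖ := by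
            rw [mul_assoc]; exact h
        _ ≤ (‖α‖ - 1) * ((‖α‖ - 1) / ‖α‖) * 2 ^ (P.natDegree - 2) := by
            apply mul_le_mul_of_nonneg_left h3
            exact mul_nonneg (by linarith) (div_nonneg (by linarith) hpos.le)
    have h5 : (‖α‖ - 1) * ((‖α‖ - 1) / ‖α‖) * 2 ^ (P.natDegree - 2) =
        (‖α‖ - 1) ^ 2 * 2 ^ (P.natDegree - 2) / ‖α‖ := by ring
    rw [h5, le_div_iff₀ hpos, one_mul] at h4
    exact h4
  -- `α` is real: choose the sign
  have hαre : α = (α.re : ℂ) := (Complex.conj_eq_iff_re.mp hconj).symm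
  have hαabs : |α.re| = ‖α‖ := by
    conv_rhs => rw [hαre]
    rw [Complex.norm_real, Real.norm_eq_abs]
  rcases le_or_gt 0 α.re with hpos | hneg
  · have hx : α.re = ‖α‖ := by rw [← hαabs, abs_of_nonneg hpos]
    apply key 1 (Or.inl rfl)
    have : ((1 : ℤ) : ℂ) - α = (((1 - α.re : ℝ)) : ℂ) := by
      conv_lhs => rw [hαre]
      push_cast; ring
    rw [this, Complex.norm_real, Real.norm_eq_abs, hx, abs_of_nonpos (by linarith)]
    ring
  · have hx : α.re = -‖α‖ := by rw [abs_of_neg hneg] at hαabs; linarith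
    apply key (-1) (Or.inr rfl)
    have : ((-1 : ℤ) : ℂ) - α = (((-1 - α.re : ℝ)) : ℂ) := by
      conv_lhs => rw [hαre]
      push_cast; ring
    rw [this, Complex.norm_real, Real.norm_eq_abs, hx, abs_of_nonneg (by linarith)]
    ring

/-- **A Salem-type measure below Lehmer's number needs degree `≥ 8`:** under the hypotheses of
`salem_measure_lower_bound`, `M(P) = ‖α‖ < 1.17629` forces `deg P ≥ 8`. -/
theorem eight_le_natDegree_of_salem_lt {P : ℤ[X]} (hirr : Irreducible P)
    (hlc : P.leadingCoeff = 1 ∨ P.leadingCoeff = -1) {α ζ : ℂ}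
    (hα : α ∈ (P.map (Int.castRingHom ℂ)).roots) (hα1 : 1 < ‖α‖)
    (hothers : ∀ β ∈ ((P.map (Int.castRingHom ℂ)).roots).erase α, ‖β‖ ≤ 1)
    (hζ : ζ ∈ (P.map (Int.castRingHom ℂ)).roots) (hζ1 : ‖ζ‖ = 1)
    (hlt : ‖α‖ < 117629 / 100000) : 8 ≤ P.natDegree := by
  have h := salem_measure_lower_bound hirr hlc hα hα1 hothers hζ hζ1
  obtain ⟨-, heven, -⟩ := salem_structure_of_irreducible hirr hα hα1 hothers hζ hζ1
  by_contra hlt8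
  push Not at hlt8
  -- `2^{n-2} ≤ 2^5 = 32` for even `n ≤ 7`, i.e. `n ≤ 6`
  have hn : P.natDegree - 2 ≤ 4 := by
    obtain ⟨j, hj⟩ := heven; omega
  have hpow : (2 : ℝ) ^ (P.natDegree - 2) ≤ 2 ^ 4 := pow_le_pow_right₀ (by norm_num) hn
  have h1 : (‖α‖ - 1) ^ 2 < (17629 / 100000 : ℝ) ^ 2 := by
    apply pow_lt_pow_left₀ (by linarith) (by linarith) two_ne_zero
  nlinarith [sq_nonneg (‖α‖ - 1)]

end Summit.Ventures.DiscreteObjects.Mahler
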